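import Literature.NumberTheory.Sieve.SieveFrameworkUpperBound
import Literature.NumberTheory.Sieve.ParityBarrierProofs
import HarnessLib

/-!
# Rough numbers in arithmetic progressions: a Brun–Titchmarsh bound (Hooley's Lemma 8)

Topic `Literature/NumberTheory/Sieve`.  An application of the tree's upper-bound sieve
(`SieveSequence.sifted_le_of_dvd_primesProdBelow`, the beta-sieve of level `D = z^{10}` for a
sifting set `P ∣ P(z)`, file `SieveFrameworkUpperBound.lean`) to the arithmetic progression
`n ≡ s (mod q)`, sifted by the primes `p < z` not dividing `q`:

* `card_roughAP_le` — there is an absolute `K` such that for all real `z ≥ 2`, all `q ≥ 1`,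
  all `s` prime to `q` and all `y ≥ 0`,
  `#{n ≤ y : n ≡ s (mod q), (n, P(z)) = 1} ≤ K · (y / (φ(q) log z) + z^{10})`,
  `P(z) = ∏_{p < z} p` (`Literature.primesProdBelow z`);
* `card_roughAP_le_of_smooth` — the same for EVERY residue `s` when all prime factors of `q` are
  `< z` (for `(s, q) > 1` the set is then empty).

This is the shape of Hooley's Lemma 8 in *On the distribution of the roots of polynomial
congruences*, Mathematika 11 (1964) 39–49 (the number of `l₂ ≤ y`, `l₂ ≡ a (mod λ)`, all of whose
prime factors exceed `x^{1/ξ}`, is `≪ y / (φ(λ) log x^{1/ξ})` in the relevant ranges), as reported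
in Martin–Sitar, Mathematika 57 (2011) §3.2 ("his Lemma 7–Lemma 8 make no reference to the
polynomial") [cite: MartinSitar2010, §3.2]; the original is not held in the literature store, so no
constant or range of Hooley's is asserted — the statement proved here is the classical
Brun–Titchmarsh-type bound for sifted progressions [folklore], cf. Halberstam–Richert,
*Sieve Methods*, Ch. 3 (the Brun–Titchmarsh theorem, their Thm 3.7; book not held, number not
re-checked).

Ingredients (all from the tree): the progression as a `SieveSequence` (built inside the proof; no new
definitions in this file) with density `g(d) = 1/d`
(`Literature.NumberTheory.Sieve.reciprocalDensity`, of sieve dimension `1`: `hasSieveDimension_reciprocalDensity_one_holds`),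
size `X = y/q`, remainders `|R_d| ≤ 2` for `(d, q) = 1` (Chinese remainder theorem and
`Nat.Ioc_filter_modEq_card`), the product `V(P) = ∏_{p < z, p ∤ q} (1 − 1/p) ≤ (q/φ(q)) / log z`
(`BombieriSieve.prod_primesBelow_one_sub_inv_le`, `MertensBound.totient_eq_mul_prod_one_sub_inv`).

## References

* C. Hooley, *On the distribution of the roots of polynomial congruences*, Mathematika 11 (1964),
  39–49, Lemma 8. [cite: Hooley1964, Lemma 8 (per MartinSitar2010 §3.2)]
* H. Halberstam, H.-E. Richert, *Sieve Methods*, Academic Press 1974, Ch. 3 (Brun–Titchmarsh via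
  Selberg's sieve; not held). [cite: HalberstamRichert1974, Ch. 3 (Brun–Titchmarsh theorem)]
-/

noncomputable section

open Finset

namespace Literature.NumberTheory.Sieve

/-! ### Counting a residue class in an interval -/

/-- `|#{0 < n ≤ M : n ≡ v (mod r)} − M/r| ≤ 1` for `r ≥ 1`. [folklore] -/
theorem abs_card_Ioc_filter_modEq_sub_div_le (M : ℕ) {r : ℕ} (hr : 0 < r) (v : ℕ) :
    |(#((Ioc 0 M).filter (fun n : ℕ => n ≡ v [MOD r])) : ℝ) - (M : ℝ) / r| ≤ 1 := by
  have h := Nat.Ioc_filter_modEq_card 0 M hr v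
  set A : ℚ := ((M : ℕ) - (v : ℕ) : ℚ) / (r : ℚ) with hA
  set B : ℚ := ((0 : ℕ) - (v : ℕ) : ℚ) / (r : ℚ) with hB
  have hr' : (0 : ℚ) < r := by exact_mod_cast hr
  have hAB : A - B = (M : ℚ) / r := by
    rw [hA, hB]
    push_cast
    field_simp
    ring
  have h1 := Int.floor_le A
  have h2 := Int.lt_floor_add_one A
  have h3 := Int.floor_le B
  have h4 := Int.lt_floor_add_one B
  -- the count, in `ℚ`
  have hq : |((#((Ioc 0 M).filter (fun n : ℕ => n ≡ v [MOD r])) : ℕ) : ℚ) - (M : ℚ) / r| ≤ 1 := by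
    have hc : (((#((Ioc 0 M).filter (fun n : ℕ => n ≡ v [MOD r])) : ℕ) : ℤ) : ℚ) =
        ((max (⌊A⌋ - ⌊B⌋) 0 : ℤ) : ℚ) := by
      exact_mod_cast h
    rw [Int.cast_natCast] at hc
    rw [hc, ← hAB, abs_le]
    have hM : (0 : ℚ) ≤ A - B := by rw [hAB]; positivity
    rcases le_total (⌊A⌋ - ⌊B⌋) 0 with hle | hle
    · rw [max_eq_right hle]
      have : ((⌊A⌋ - ⌊B⌋ : ℤ) : ℚ) ≤ 0 := by exact_mod_cast hle
      push_cast at this ⊢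
      constructor <;> linarith
    · rw [max_eq_left hle]
      push_cast
      constructor <;> linarith
  have := (Rat.cast_le (K := ℝ)).2 hq
  push_cast at this
  exact this

/-! ### The progression `n ≡ s (mod q)` as a sifted sequence -/

section AP

variable {A : SieveSequence} {q s : ℕ}

/-- For a sifted sequence with indicator terms `a_n = 1_{n ≡ s (q)}`:
`A_d(y) = #{0 < n ≤ y : n ≡ s (q), d ∣ n}`. [folklore] -/
theorem SieveSequence.congrSum_eq_card_of_modEq
    (hA : ∀ n, A.a n = if n ≡ s [MOD q] then 1 else 0) (d : ℕ) (y : ℝ) :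
    A.congrSum d y = #((Ioc 0 ⌊y⌋₊).filter (fun n : ℕ => n ≡ s [MOD q] ∧ d ∣ n)) := by
  rw [SieveSequence.congrSum, Finset.card_eq_sum_ones, Finset.sum_filter, Finset.sum_filter]
  push_cast
  refine Finset.sum_congr rfl fun n _ => ?_
  simp only [hA]
  by_cases h1 : d ∣ n <;> by_cases h2 : n ≡ s [MOD q] <;> simp [h1, h2]

/-- **Chinese remainder theorem for the progression**: for `(q, d) = 1` there is `c` with
`{n : n ≡ s (q), d ∣ n} = {n : n ≡ c (q d)}`. [folklore] -/
theorem exists_modEq_and_dvd_iff {q d : ℕ} (hqd : q.Coprime d) (s : ℕ) :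
    ∃ c : ℕ, ∀ n : ℕ, (n ≡ s [MOD q] ∧ d ∣ n) ↔ n ≡ c [MOD q * d] := by
  obtain ⟨c, hc1, hc2⟩ := Nat.chineseRemainder hqd s 0
  refine ⟨c, fun n => ?_⟩
  rw [← Nat.modEq_and_modEq_iff_modEq_mul hqd, Nat.dvd_iff_mod_eq_zero]
  constructor
  · rintro ⟨h1, h2⟩
    exact ⟨h1.trans hc1.symm, (show n ≡ 0 [MOD d] from h2).trans hc2.symm⟩
  · rintro ⟨h1, h2⟩
    exact ⟨h1.trans hc1, h2.trans hc2⟩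

/-- **The remainders of the progression are bounded**: for `q ≥ 1`, `(q, d) = 1`, `d ≥ 1` and
`y ≥ 0`, `|R_d(y)| = |#{0 < n ≤ y : n ≡ s (q), d ∣ n} − y/(q d)| ≤ 2`. [folklore] -/
theorem SieveSequence.abs_remainder_le_two_of_modEq
    (hA : ∀ n, A.a n = if n ≡ s [MOD q] then 1 else 0) (hsize : ∀ y, A.size y = y / q)
    (hdens : A.density = reciprocalDensity) {d : ℕ} (hq : 0 < q) (hd : 0 < d)
    (hqd : q.Coprime d) {y : ℝ} (hy : 0 ≤ y) :
    |A.remainder d y| ≤ 2 := by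
  obtain ⟨c, hc⟩ := exists_modEq_and_dvd_iff hqd s
  have hqd0 : 0 < q * d := Nat.mul_pos hq hd
  rw [SieveSequence.remainder, SieveSequence.congrSum_eq_card_of_modEq hA, hdens,
    reciprocalDensity_apply, hsize]
  have hset : (Ioc 0 ⌊y⌋₊).filter (fun n : ℕ => n ≡ s [MOD q] ∧ d ∣ n) =
      (Ioc 0 ⌊y⌋₊).filter (fun n : ℕ => n ≡ c [MOD q * d]) := by
    ext n
    simp only [mem_filter, hc n]
  rw [hset]
  have h1 := abs_card_Ioc_filter_modEq_sub_div_le ⌊y⌋₊ hqd0 c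
  have h2 : |((⌊y⌋₊ : ℕ) : ℝ) / ((q * d : ℕ) : ℝ) - (d : ℝ)⁻¹ * (y / q)| ≤ 1 := by
    have hfl : ((⌊y⌋₊ : ℕ) : ℝ) ≤ y := Nat.floor_le hy
    have hfl' : y < ((⌊y⌋₊ : ℕ) : ℝ) + 1 := Nat.lt_floor_add_one y
    have hqd1 : (1 : ℝ) ≤ ((q * d : ℕ) : ℝ) := by exact_mod_cast hqd0
    have hqd0' : (0 : ℝ) < ((q * d : ℕ) : ℝ) := by positivity
    have heq : (d : ℝ)⁻¹ * (y / q) = y / ((q * d : ℕ) : ℝ) := by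
      push_cast
      field_simp
    rw [heq, ← sub_div, abs_div, abs_of_pos hqd0', div_le_iff₀ hqd0', abs_le]
    constructor <;> nlinarith
  calc |((#((Ioc 0 ⌊y⌋₊).filter (fun n : ℕ => n ≡ c [MOD q * d])) : ℕ) : ℝ) - (d : ℝ)⁻¹ * (y / q)|
      = |((((#((Ioc 0 ⌊y⌋₊).filter (fun n : ℕ => n ≡ c [MOD q * d])) : ℕ) : ℝ) -
            ((⌊y⌋₊ : ℕ) : ℝ) / ((q * d : ℕ) : ℝ)) +
          (((⌊y⌋₊ : ℕ) : ℝ) / ((q * d : ℕ) : ℝ) - (d : ℝ)⁻¹ * (y / q)))| := by ring_nf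
    _ ≤ _ := abs_add_le _ _
    _ ≤ 1 + 1 := add_le_add h1 h2
    _ = 2 := by norm_num

end AP

/-! ### The sifting set and its density product -/

/-- The sifting set `∏_{p < z, p ∤ q} p` (the primes below `z` not dividing `q`) divides
`P(z)`. [folklore] -/
theorem prod_primesBelow_filter_not_dvd_dvd (z : ℝ) (q : ℕ) :
    (∏ p ∈ (Nat.primesBelow ⌈z⌉₊).filter (fun p : ℕ => ¬ p ∣ q), p) ∣ primesProdBelow z :=
  Finset.prod_dvd_prod_of_subset _ _ _ (Finset.filter_subset _ _)

/-- The prime factors of `∏_{p < z, p ∤ q} p`. [folklore] -/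
theorem primeFactors_prod_primesBelow_filter_not_dvd (z : ℝ) (q : ℕ) :
    (∏ p ∈ (Nat.primesBelow ⌈z⌉₊).filter (fun p : ℕ => ¬ p ∣ q), p).primeFactors =
      (Nat.primesBelow ⌈z⌉₊).filter (fun p : ℕ => ¬ p ∣ q) :=
  Nat.primeFactors_prod fun _ hp => Nat.prime_of_mem_primesBelow (Finset.mem_filter.1 hp).1

/-- `∏_{p < z, p ∤ q} p` is prime to `q`. [folklore] -/
theorem coprime_prod_primesBelow_filter_not_dvd (z : ℝ) (q : ℕ) :
    (∏ p ∈ (Nat.primesBelow ⌈z⌉₊).filter (fun p : ℕ => ¬ p ∣ q), p).Coprime q := by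
  refine Nat.Coprime.prod_left fun p hp => ?_
  obtain ⟨hp, hpq⟩ := Finset.mem_filter.1 hp
  exact (Nat.prime_of_mem_primesBelow hp).coprime_iff_not_dvd.2 hpq

/-- **The density product of the sifted progression**:
`V(P) · φ(q)/q ≤ ∏_{p < z} (1 − 1/p) ≤ 1 / log z` for `P = ∏_{p < z, p ∤ q} p`, `q ≥ 1`, `z > 1`
(the primes of `q` below `z` restore the full Mertens product; those above only help). [folklore] -/
theorem SieveSequence.densityProduct_prod_primesBelow_filter_not_dvd_le {A : SieveSequence}
    (hdens : A.density = reciprocalDensity) {z : ℝ} (hz : 1 < z) {q : ℕ} (hq : 0 < q) :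
    A.densityProduct (∏ p ∈ (Nat.primesBelow ⌈z⌉₊).filter (fun p : ℕ => ¬ p ∣ q), p) ≤
      ((q : ℝ) / Nat.totient q) / Real.log z := by
  have hφ0 : (0 : ℝ) < Nat.totient q := by exact_mod_cast Nat.totient_pos.2 hq
  have hq0 : (0 : ℝ) < q := by exact_mod_cast hq
  -- `V(P) * ∏_{p ∣ q} (1 - 1/p) ≤ ∏_{p < z} (1 - 1/p)`
  set T := Nat.primesBelow ⌈z⌉₊ with hT
  have hfac : ∀ p : ℕ, p.Prime → 0 ≤ 1 - (p : ℝ)⁻¹ ∧ 1 - (p : ℝ)⁻¹ ≤ 1 := by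
    intro p hp
    refine ⟨sub_nonneg.2 (inv_le_one_of_one_le₀ (by exact_mod_cast hp.one_lt.le)), ?_⟩
    exact sub_le_self _ (inv_nonneg.2 (Nat.cast_nonneg p))
  have hV : A.densityProduct (∏ p ∈ (Nat.primesBelow ⌈z⌉₊).filter (fun p : ℕ => ¬ p ∣ q), p) =
      ∏ p ∈ T.filter (fun p : ℕ => ¬ p ∣ q), (1 - (p : ℝ)⁻¹) := by
    rw [SieveSequence.densityProduct, primeFactors_prod_primesBelow_filter_not_dvd, hdens]
    rfl
  have hsplit : ∏ p ∈ T, (1 - (p : ℝ)⁻¹) =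
      (∏ p ∈ T.filter (fun p : ℕ => ¬ p ∣ q), (1 - (p : ℝ)⁻¹)) *
        ∏ p ∈ T.filter (fun p : ℕ => p ∣ q), (1 - (p : ℝ)⁻¹) := by
    rw [mul_comm, Finset.prod_filter_mul_prod_filter_not]
  have hsub : T.filter (fun p : ℕ => p ∣ q) ⊆ q.primeFactors := by
    intro p hp
    obtain ⟨hp, hpq⟩ := Finset.mem_filter.1 hp
    exact Nat.mem_primeFactors.2 ⟨Nat.prime_of_mem_primesBelow hp, hpq, hq.ne'⟩
  have hmono : ∏ p ∈ q.primeFactors, (1 - (p : ℝ)⁻¹) ≤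
      ∏ p ∈ T.filter (fun p : ℕ => p ∣ q), (1 - (p : ℝ)⁻¹) :=
    Finset.prod_le_prod_of_subset_of_le_one hsub
      (fun p hp => (hfac p (Nat.prime_of_mem_primeFactors hp)).1)
      (fun p hp _ => (hfac p (Nat.prime_of_mem_primeFactors hp)).2)
  have hφ : ∏ p ∈ q.primeFactors, (1 - (p : ℝ)⁻¹) = (Nat.totient q : ℝ) / q := by
    rw [LFunctions.MertensBound.totient_eq_mul_prod_one_sub_inv, mul_div_cancel_left₀ _ hq0.ne']
    simp only [one_div]
  have hM : ∏ p ∈ T, (1 - (p : ℝ)⁻¹) ≤ 1 / Real.log z :=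
    BombieriSieve.prod_primesBelow_one_sub_inv_le hz
  have hVnn : 0 ≤ ∏ p ∈ T.filter (fun p : ℕ => ¬ p ∣ q), (1 - (p : ℝ)⁻¹) :=
    Finset.prod_nonneg fun p hp => (hfac p (Nat.prime_of_mem_primesBelow (Finset.mem_filter.1 hp).1)).1
  have key : (∏ p ∈ T.filter (fun p : ℕ => ¬ p ∣ q), (1 - (p : ℝ)⁻¹)) * ((Nat.totient q : ℝ) / q) ≤
      1 / Real.log z := by
    calc (∏ p ∈ T.filter (fun p : ℕ => ¬ p ∣ q), (1 - (p : ℝ)⁻¹)) * ((Nat.totient q : ℝ) / q)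
        = (∏ p ∈ T.filter (fun p : ℕ => ¬ p ∣ q), (1 - (p : ℝ)⁻¹)) *
            ∏ p ∈ q.primeFactors, (1 - (p : ℝ)⁻¹) := by rw [hφ]
      _ ≤ (∏ p ∈ T.filter (fun p : ℕ => ¬ p ∣ q), (1 - (p : ℝ)⁻¹)) *
            ∏ p ∈ T.filter (fun p : ℕ => p ∣ q), (1 - (p : ℝ)⁻¹) :=
          mul_le_mul_of_nonneg_left hmono hVnn
      _ = ∏ p ∈ T, (1 - (p : ℝ)⁻¹) := hsplit.symm
      _ ≤ 1 / Real.log z := hM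
  rw [hV]
  have hφq : (0 : ℝ) < (Nat.totient q : ℝ) / q := by positivity
  rw [← le_div_iff₀ hφq] at key
  refine key.trans (le_of_eq ?_)
  field_simp

/-! ### The Brun–Titchmarsh bound for rough numbers in a progression -/

/-- **Rough numbers in an arithmetic progression (Hooley's Lemma 8, Brun–Titchmarsh form).**
There is an absolute constant `K > 0` such that for all real `z ≥ 2`, all `q ≥ 1`, all `s` with
`(s, q) = 1` and all real `y ≥ 0`,
`#{0 < n ≤ y : n ≡ s (mod q), (n, P(z)) = 1} ≤ K · (y / (φ(q) log z) + z^{10})`,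
where `P(z) = ∏_{p < z} p`; i.e. the integers of the progression free of prime factors `< z`
number `≪ y/(φ(q) log z)` as soon as `y ≥ φ(q) z^{10} log z`.  Proof: the beta-sieve upper bound
of level `D = z^{10}` (`SieveSequence.sifted_le_of_dvd_primesProdBelow`, dimension `κ = 1`) for
the progression sifted by the primes `p < z`, `p ∤ q`, with `X = y/q`,
`V(P) ≤ (q/φ(q))/log z` and `|R_d| ≤ 2`.
[cite: Hooley1964, Lemma 8 (per MartinSitar2010 §3.2; original not held, no constant of Hooley's asserted)];
[cite: HalberstamRichert1974, Ch. 3 (Brun–Titchmarsh theorem)]; the bound itself is [folklore]. -/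
theorem card_roughAP_le :
    ∃ K : ℝ, 0 < K ∧ ∀ z : ℝ, 2 ≤ z → ∀ q : ℕ, 0 < q → ∀ s : ℕ, s.Coprime q → ∀ y : ℝ, 0 ≤ y →
      (#((Ioc 0 ⌊y⌋₊).filter
          (fun n : ℕ => n ≡ s [MOD q] ∧ n.Coprime (primesProdBelow z))) : ℝ) ≤
        K * (y / ((Nat.totient q : ℝ) * Real.log z) + z ^ (10 : ℕ)) := by
  obtain ⟨K₀, hK₀⟩ := hasSieveDimension_reciprocalDensity_one_holds
  have hK₀1 : 1 ≤ K₀ := hK₀.one_le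
  refine ⟨1 + 2 * K₀ ^ (10 : ℕ), by positivity, fun z hz q hq s hs y hy => ?_⟩
  have hz1 : 1 < z := by linarith
  have hz0 : 0 < z := by linarith
  have hlogz : 0 < Real.log z := Real.log_pos hz1
  have hφ0 : (0 : ℝ) < Nat.totient q := by exact_mod_cast Nat.totient_pos.2 hq
  -- the progression as a sifted sequence: `a_n = 1_{n ≡ s (q)}`, `X(y) = y/q`, `g(d) = 1/d`
  let A : SieveSequence :=
    { a := fun n => if n ≡ s [MOD q] then 1 else 0
      a_nonneg := fun n => by
        split_ifs
        · exact zero_le_one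
        · exact le_rfl
      size := fun y => y / q
      density := reciprocalDensity
      density_mult := isMultiplicative_reciprocalDensity }
  have hAa : ∀ n, A.a n = if n ≡ s [MOD q] then 1 else 0 := fun n => rfl
  have hsize : ∀ y, A.size y = y / q := fun y => rfl
  have hdens : A.density = reciprocalDensity := rfl
  -- the sifting set `P = ∏_{p < z, p ∤ q} p` and the level `D = z^{10}`
  set P := ∏ p ∈ (Nat.primesBelow ⌈z⌉₊).filter (fun p : ℕ => ¬ p ∣ q), p with hP
  set D : ℝ := z ^ (10 : ℕ) with hD
  have hdim : HasSieveDimension A.density 1 K₀ := hK₀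
  have hD1 : 1 < D := one_lt_pow₀ hz1 (by norm_num)
  have hzD : (9 * (1 : ℝ) + 1) * Real.log z ≤ Real.log D := by
    rw [hD, Real.log_pow]; norm_num
  have hX : 0 ≤ A.size y := by
    rw [hsize]; positivity
  have hsieve := SieveSequence.sifted_le_of_dvd_primesProdBelow hdim one_pos hz hD1 hzD hX
    (prod_primesBelow_filter_not_dvd_dvd z q)
  -- the exponential factor is `1`
  have hexp : Real.exp ((9 * (1 : ℝ) + 1) - Real.log D / Real.log z) = 1 := by
    rw [hD, Real.log_pow, Nat.cast_ofNat, mul_div_assoc, div_self hlogz.ne']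
    norm_num
  rw [hexp, mul_one] at hsieve
  -- the set to count is inside the sifted set
  have hcount : (#((Ioc 0 ⌊y⌋₊).filter
      (fun n : ℕ => n ≡ s [MOD q] ∧ n.Coprime (primesProdBelow z))) : ℝ) ≤ A.sifted y P := by
    classical
    rw [A.sifted_eq_card {n : ℕ | n ≡ s [MOD q]} (fun n => by rw [hAa]; rfl) y P]
    have hsub : (Ioc 0 ⌊y⌋₊).filter
        (fun n : ℕ => n ≡ s [MOD q] ∧ n.Coprime (primesProdBelow z)) ⊆
        (Ioc 0 ⌊y⌋₊).filter (fun n : ℕ => n ≡ s [MOD q] ∧ n.Coprime P) := by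
      intro n hn
      rw [Finset.mem_filter] at hn ⊢
      exact ⟨hn.1, hn.2.1,
        Nat.Coprime.coprime_dvd_right (prod_primesBelow_filter_not_dvd_dvd z q) hn.2.2⟩
    exact_mod_cast Finset.card_le_card hsub
  -- main term
  have hmain : A.size y * A.densityProduct P ≤ y / ((Nat.totient q : ℝ) * Real.log z) := by
    rw [hsize]
    calc y / q * A.densityProduct P
        ≤ y / q * (((q : ℝ) / Nat.totient q) / Real.log z) :=
          mul_le_mul_of_nonneg_left
            (SieveSequence.densityProduct_prod_primesBelow_filter_not_dvd_le hdens hz1 hq)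
            (by positivity)
      _ = y / ((Nat.totient q : ℝ) * Real.log z) := by
          have hq0 : (q : ℝ) ≠ 0 := by exact_mod_cast hq.ne'
          field_simp
  -- remainder term
  have hrem : ∑ d ∈ P.divisors.filter (fun d : ℕ => (d : ℝ) ≤ D), |A.remainder d y| ≤ 2 * D := by
    have hP0 : P ≠ 0 := by
      rw [hP]
      exact Finset.prod_ne_zero_iff.2 fun p hp =>
        (Nat.prime_of_mem_primesBelow (Finset.mem_filter.1 hp).1).ne_zero
    calc ∑ d ∈ P.divisors.filter (fun d : ℕ => (d : ℝ) ≤ D), |A.remainder d y|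
        ≤ ∑ d ∈ P.divisors.filter (fun d : ℕ => (d : ℝ) ≤ D), (2 : ℝ) := by
          refine Finset.sum_le_sum fun d hd => ?_
          obtain ⟨hd, -⟩ := Finset.mem_filter.1 hd
          have hdP : d ∣ P := Nat.dvd_of_mem_divisors hd
          have hd0 : 0 < d := Nat.pos_of_mem_divisors hd
          have hqd : q.Coprime d :=
            (Nat.Coprime.coprime_dvd_left hdP (coprime_prod_primesBelow_filter_not_dvd z q)).symm
          exact SieveSequence.abs_remainder_le_two_of_modEq hAa hsize hdens hq hd0 hqd hy
      _ = 2 * #(P.divisors.filter (fun d : ℕ => (d : ℝ) ≤ D)) := by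
          rw [Finset.sum_const, nsmul_eq_mul, mul_comm]
      _ ≤ 2 * #(Icc 1 ⌊D⌋₊) := by
          gcongr
          intro d hd
          obtain ⟨hd, hdD⟩ := Finset.mem_filter.1 hd
          rw [Finset.mem_Icc]
          exact ⟨Nat.pos_of_mem_divisors hd, Nat.le_floor hdD⟩
      _ ≤ 2 * D := by
          rw [Nat.card_Icc, Nat.add_sub_cancel]
          exact mul_le_mul_of_nonneg_left (Nat.floor_le (by positivity)) (by norm_num)
  -- assemble
  have hK : (0 : ℝ) ≤ 1 + 2 * K₀ ^ (10 : ℕ) := by positivity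
  have h2 : (2 : ℝ) ≤ 1 + 2 * K₀ ^ (10 : ℕ) := by
    have : (1 : ℝ) ≤ K₀ ^ (10 : ℕ) := one_le_pow₀ hK₀1
    linarith
  calc (#((Ioc 0 ⌊y⌋₊).filter
          (fun n : ℕ => n ≡ s [MOD q] ∧ n.Coprime (primesProdBelow z))) : ℝ)
      ≤ A.sifted y P := hcount
    _ ≤ (1 + 2 * K₀ ^ (10 : ℕ)) * (A.size y * A.densityProduct P) +
          ∑ d ∈ P.divisors.filter (fun d : ℕ => (d : ℝ) ≤ D), |A.remainder d y| := hsieve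
    _ ≤ (1 + 2 * K₀ ^ (10 : ℕ)) * (y / ((Nat.totient q : ℝ) * Real.log z)) + 2 * D :=
        add_le_add (mul_le_mul_of_nonneg_left hmain hK) hrem
    _ ≤ (1 + 2 * K₀ ^ (10 : ℕ)) * (y / ((Nat.totient q : ℝ) * Real.log z)) +
          (1 + 2 * K₀ ^ (10 : ℕ)) * D :=
        by
          have hD0 : (0 : ℝ) ≤ D := by positivity
          nlinarith [mul_le_mul_of_nonneg_right h2 hD0]
    _ = (1 + 2 * K₀ ^ (10 : ℕ)) * (y / ((Nat.totient q : ℝ) * Real.log z) + z ^ (10 : ℕ)) := by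
        rw [hD]; ring

/-- **Rough numbers in a progression to a smooth modulus, any residue.**  With the constant `K`
of `card_roughAP_le`: for real `z ≥ 2`, a modulus `q` all of whose prime factors are `< z`
(`q ∈ Nat.smoothNumbers ⌈z⌉₊`), EVERY residue `s` and real `y ≥ 0`,
`#{0 < n ≤ y : n ≡ s (mod q), (n, P(z)) = 1} ≤ K · (y / (φ(q) log z) + z^{10})`
(if `(s, q) > 1` a common prime factor is `< z` and divides every such `n`, so the set is empty).
This is the form used in Hooley's argument, where `q = k₁` is the smooth part of the modulus.
[cite: Hooley1964, Lemma 8 (per MartinSitar2010 §3.2)]; [folklore] -/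
theorem card_roughAP_le_of_smooth :
    ∃ K : ℝ, 0 < K ∧ ∀ z : ℝ, 2 ≤ z → ∀ q : ℕ, q ∈ Nat.smoothNumbers ⌈z⌉₊ → ∀ s : ℕ, ∀ y : ℝ,
      0 ≤ y →
      (#((Ioc 0 ⌊y⌋₊).filter
          (fun n : ℕ => n ≡ s [MOD q] ∧ n.Coprime (primesProdBelow z))) : ℝ) ≤
        K * (y / ((Nat.totient q : ℝ) * Real.log z) + z ^ (10 : ℕ)) := by
  obtain ⟨K, hK, h⟩ := card_roughAP_le
  refine ⟨K, hK, fun z hz q hq s y hy => ?_⟩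
  have hq0 : 0 < q := Nat.pos_of_ne_zero (Nat.ne_zero_of_mem_smoothNumbers hq)
  by_cases hs : s.Coprime q
  · exact h z hz q hq0 s hs y hy
  · -- the set is empty
    have hempty : (Ioc 0 ⌊y⌋₊).filter
        (fun n : ℕ => n ≡ s [MOD q] ∧ n.Coprime (primesProdBelow z)) = ∅ := by
      rw [Finset.filter_eq_empty_iff]
      rintro n - ⟨hns, hnP⟩
      rw [Nat.coprime_iff_gcd_eq_one] at hs
      obtain ⟨p, hp, hpg⟩ := Nat.exists_prime_and_dvd hs
      have hps : p ∣ s := hpg.trans (Nat.gcd_dvd_left _ _)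
      have hpq : p ∣ q := hpg.trans (Nat.gcd_dvd_right _ _)
      -- `p < z`
      have hpz : p < ⌈z⌉₊ := (Nat.mem_smoothNumbers'.1 hq) p hp hpq
      have hpP : p ∣ primesProdBelow z := (dvd_primesProdBelow_iff hp z).2 (Nat.lt_ceil.1 hpz)
      -- `p ∣ n`
      have hpn : p ∣ n := by
        have h1 : n ≡ s [MOD p] := Nat.ModEq.of_dvd hpq hns
        have h2 : s ≡ 0 [MOD p] := (Nat.modEq_zero_iff_dvd).2 hps
        exact (Nat.modEq_zero_iff_dvd).1 (h1.trans h2)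
      exact Nat.not_coprime_of_dvd_of_dvd hp.one_lt hpn hpP hnP
    rw [hempty, Finset.card_empty, Nat.cast_zero]
    have hlogz : 0 < Real.log z := Real.log_pos (by linarith)
    have hφ0 : (0 : ℝ) < Nat.totient q := by exact_mod_cast Nat.totient_pos.2 hq0
    positivity

end Literature.NumberTheory.Sieve
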